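import Summits.BirchSwinnertonDyer.BirchSwinnertonDyer.Theorems.ClassRecordThreeEulerHalvesAtThreeCartanCoverPeriodLattice
import HarnessLib

/-!
# Crux NUM `CartanOnePlaceDegreeLawAtThree` (item 24801), analytic dictionary D1 — slice 7: GENERIC TORUS DOCKING (the split side `u_S` included)

Seat `bsd-stepL-tam3-p1` g26 (LEAD of 19109 ∕ 23422; `--supports` 23422; memo `HOME/tam3-p1/g26/NUM-LINES-AND-D1-DESIGN-g26.md` rev 2 §4 (iii), §7). Generalises
`…CartanCoverDocking` (p727426) from the non-split torus `T_η` (whose level group is `X.Gamma` by pinning) to ANY subgroup `T ≤ GL₂(𝔽_q)`: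
* `R.levelOf T ≤ ι(O₀'¹)` — the level group `redHom⁻¹(T)` (contains `Γ̄(q)`); `levelOf (torusSubgroup η)`'s members are exactly the members of `X.Gamma` (`mem_levelOf_torus_iff`).
* `levelOf_torus_eq : levelOf T_η = X.Gamma` and `dockTorus_torus_eq_dockNonsplit` (the docking of `…CartanCoverDocking` is the case `T = T_η`).
* `R.dockTorus T F : R.IndCuspForm` for `F ∈ S₂(levelOf T)` — value `ρ(γ) F|_{Γ̄}` at `g = redHom γ · t` (`t ∈ T`), zero off the double coset `redHom(ι(O₀'¹))·T`; PROVED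
  well defined, `dockTorus_apply_one = F|_{Γ̄}`, `T`-invariant under `indRep`, component periods in `Λ` when `F` has its `levelOf T`-periods in `Λ`.
USE: with `T = splitTorusSub q`-type diagonal torus and `F` = the class-minimal `Q'.form` transported to `S₂(levelOf T_s)` (bsd-idea-10 g17 road HT (α) + the split-Cartan
hull (β)), `dockTorus` gives the split vector `u_S` of `SplitSideSheetAtThree` (`…CartanCoverAssembly`), whose MIXED stub then splits into cite + descent.
Definitions + elementary lemmas; nothing about degrees or any curve; BSD is proved for no curve. [cite: KohenPacetti2016, §1.3 and §2 (arXiv:1403.7801v3 pp. 5–8)]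
-/

set_option linter.dupNamespace false
set_option autoImplicit false

noncomputable section

open scoped Classical Pointwise MatrixGroups

namespace Summit.BirchSwinnertonDyer.BirchSwinnertonDyer.Theorems.CartanCover

open Literature.NumberTheory.Automorphic Literature.NumberTheory.EllipticCurves.ModularForms

variable {D M : ℕ} {C : Finset ℕ} {X : CartanLevelCurveData D M C} {q : ℕ}

namespace CoverReduction

variable [Fact q.Prime] (R : CoverReduction X q)

/-! ## §1 The level group over a subgroup of `GL₂(𝔽_q)` -/

/-- **`Γ_T := redHom⁻¹(T)`** as a subgroup of `GL(2, ℝ)` (inside `ι(O₀'¹)`). -/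
def levelOf (T : Subgroup (GL (Fin 2) (ZMod q))) : Subgroup (GL (Fin 2) ℝ) :=
  (T.comap R.redHom).map (coverUnits X q).subtype

/-- Membership in `Γ_T`: `g ∈ ι(O₀'¹)` and `redHom g ∈ T`. -/
theorem mem_levelOf_iff (T : Subgroup (GL (Fin 2) (ZMod q))) {g : GL (Fin 2) ℝ} :
    g ∈ R.levelOf T ↔ ∃ h : g ∈ coverUnits X q, R.redHom ⟨g, h⟩ ∈ T := by
  unfold levelOf
  rw [Subgroup.mem_map]
  constructor
  · rintro ⟨γ, hγ, rfl⟩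
    exact ⟨γ.2, by rw [Subgroup.mem_comap] at hγ; simpa using hγ⟩
  · rintro ⟨h, hT⟩
    exact ⟨⟨g, h⟩, Subgroup.mem_comap.mpr hT, rfl⟩

/-- `Γ_T ≤ ι(O₀'¹)`. -/
theorem levelOf_le (T : Subgroup (GL (Fin 2) (ZMod q))) : R.levelOf T ≤ coverUnits X q := by
  intro g hg
  obtain ⟨h, -⟩ := (R.mem_levelOf_iff T).mp hg
  exact h

/-- `Γ̄(q) ≤ Γ_T` (the kernel of `redHom` lies over every `T`). -/
theorem principalLevel_le_levelOf (T : Subgroup (GL (Fin 2) (ZMod q))) : principalLevel X q ≤ R.levelOf T := by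
  intro g hg
  refine (R.mem_levelOf_iff T).mpr ⟨principalLevel_le_coverUnits X q hg, ?_⟩
  have h1 : R.redHom ⟨g, principalLevel_le_coverUnits X q hg⟩ = 1 := (R.mem_ker_redHom_iff _).mpr hg
  rw [h1]; exact T.one_mem

/-- A unit `γ ∈ ι(O₀'¹)` lies in `Γ_T` iff `redHom γ ∈ T`. -/
theorem coe_mem_levelOf_iff (T : Subgroup (GL (Fin 2) (ZMod q))) (γ : coverUnits X q) : (γ : GL (Fin 2) ℝ) ∈ R.levelOf T ↔ R.redHom γ ∈ T := by
  rw [R.mem_levelOf_iff T]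
  constructor
  · rintro ⟨h, hT⟩; exact hT
  · intro hT; exact ⟨γ.2, hT⟩

/-- For the non-split torus `T_η` the level group has the same members as `X.Gamma` (pinning). -/
theorem mem_levelOf_torus_iff {g : GL (Fin 2) ℝ} :
    g ∈ R.levelOf (CartanTorusCubeCut.torusSubgroup R.η) ↔ g ∈ X.Gamma := by
  constructor
  · intro hg
    obtain ⟨h, hT⟩ := (R.mem_levelOf_iff _).mp hg
    exact (R.redHom_mem_torus_iff ⟨g, h⟩).mp hT
  · intro hg
    exact (R.mem_levelOf_iff _).mpr ⟨Gamma_le_coverUnits X q hg, (R.redHom_mem_torus_iff ⟨g, Gamma_le_coverUnits X q hg⟩).mpr hg⟩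

/-! ## §2 Restriction of `Γ_T`-forms to `Γ̄(q)` -/

/-- `S₂(Γ_T) → S₂(Γ̄(q))` (the tree's `cuspFormOfLE`). -/
def restrictLevel (T : Subgroup (GL (Fin 2) (ZMod q))) (F : CuspForm (R.levelOf T) 2) : CuspForm (principalLevel X q) 2 :=
  cuspFormOfLE (R.principalLevel_le_levelOf T) F

/-- `restrictLevel` does not change the function. -/
@[simp] theorem coe_restrictLevel (T : Subgroup (GL (Fin 2) (ZMod q))) (F : CuspForm (R.levelOf T) 2) : ⇑(R.restrictLevel T F) = ⇑F := rfl

/-- `Γ_T` fixes the restriction of a `Γ_T`-form. -/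
theorem coverRep_restrictLevel_of_mem (T : Subgroup (GL (Fin 2) (ZMod q))) (F : CuspForm (R.levelOf T) 2) {γ : coverUnits X q} (hγ : R.redHom γ ∈ T) :
    coverRep X q γ (R.restrictLevel T F) = R.restrictLevel T F := by
  apply CuspForm.ext; intro τ
  rw [coverRep_apply, coe_coverSlash, coe_restrictLevel]
  have hmem : ((γ : GL (Fin 2) ℝ))⁻¹ ∈ R.levelOf T := (R.levelOf T).inv_mem ((R.coe_mem_levelOf_iff T γ).mpr hγ)
  exact congr_fun (SlashInvariantForm.slash_action_eqn F _ hmem) τ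

/-! ## §3 Docking over `T` -/

/-- The double coset `redHom(ι(O₀'¹)) · T`. -/
def torusCoset (T : Subgroup (GL (Fin 2) (ZMod q))) : Set (GL (Fin 2) (ZMod q)) := {g | ∃ γ : coverUnits X q, (R.redHom γ)⁻¹ * g ∈ T}

/-- Membership in the double coset (definitional). -/
theorem mem_torusCoset_iff (T : Subgroup (GL (Fin 2) (ZMod q))) (g : GL (Fin 2) (ZMod q)) :
    g ∈ R.torusCoset T ↔ ∃ γ : coverUnits X q, (R.redHom γ)⁻¹ * g ∈ T := Iff.rfl

/-- Two decompositions differ by an element of `redHom⁻¹(T)`. -/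
theorem redHom_inv_mul_mem_of_witnesses (T : Subgroup (GL (Fin 2) (ZMod q))) {g : GL (Fin 2) (ZMod q)} {γ₀ γ₁ : coverUnits X q}
    (h₀ : (R.redHom γ₀)⁻¹ * g ∈ T) (h₁ : (R.redHom γ₁)⁻¹ * g ∈ T) : R.redHom (γ₁⁻¹ * γ₀) ∈ T := by
  have e : R.redHom (γ₁⁻¹ * γ₀) = ((R.redHom γ₁)⁻¹ * g) * ((R.redHom γ₀)⁻¹ * g)⁻¹ := by rw [map_mul, map_inv]; group
  rw [e]; exact T.mul_mem h₁ (T.inv_mem h₀)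

/-- Hence `ρ(γ) F|_{Γ̄}` does not depend on the decomposition. -/
theorem coverRep_restrictLevel_eq_of_witnesses (T : Subgroup (GL (Fin 2) (ZMod q))) (F : CuspForm (R.levelOf T) 2) {g : GL (Fin 2) (ZMod q)}
    {γ₀ γ₁ : coverUnits X q} (h₀ : (R.redHom γ₀)⁻¹ * g ∈ T) (h₁ : (R.redHom γ₁)⁻¹ * g ∈ T) :
    coverRep X q γ₀ (R.restrictLevel T F) = coverRep X q γ₁ (R.restrictLevel T F) := by
  have hfix := R.coverRep_restrictLevel_of_mem T F (R.redHom_inv_mul_mem_of_witnesses T h₀ h₁)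
  have h := congrArg (coverRep X q γ₁) hfix
  rw [← Module.End.mul_apply, ← map_mul, mul_inv_cancel_left] at h
  exact h

/-- **`dockTorus T F`**: the element of the induced module equal to `ρ(γ) F|_{Γ̄}` at `g = redHom γ · t` (`t ∈ T`) and `0` off the double coset. -/
def dockTorus (T : Subgroup (GL (Fin 2) (ZMod q))) (F : CuspForm (R.levelOf T) 2) : R.IndCuspForm :=
  ⟨fun g => if h : g ∈ R.torusCoset T then coverRep X q (Classical.choose h) (R.restrictLevel T F) else 0, by
    intro γ g
    by_cases hg : g ∈ R.torusCoset T
    · have hg' : (R.redHom γ * g) ∈ R.torusCoset T := by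
        obtain ⟨γ₀, h₀⟩ := hg
        refine ⟨γ * γ₀, ?_⟩
        rwa [map_mul, mul_inv_rev, mul_assoc, inv_mul_cancel_left]
      simp only [dif_pos hg, dif_pos hg']
      have h₁ := Classical.choose_spec hg'
      have h₀ : (R.redHom (γ * Classical.choose hg))⁻¹ * (R.redHom γ * g) ∈ T := by
        rw [map_mul, mul_inv_rev, mul_assoc, inv_mul_cancel_left]
        exact Classical.choose_spec hg
      rw [R.coverRep_restrictLevel_eq_of_witnesses T F h₁ h₀, map_mul, Module.End.mul_apply]
    · have hg' : ¬ (R.redHom γ * g) ∈ R.torusCoset T := by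
        rintro ⟨γ₁, h₁⟩
        exact hg ⟨γ⁻¹ * γ₁, by rwa [map_mul, map_inv, mul_inv_rev, inv_inv, mul_assoc]⟩
      simp only [dif_neg hg, dif_neg hg', map_zero]⟩

/-- The value of `dockTorus` on the double coset, for ANY witness. -/
theorem dockTorus_apply_of_witness (T : Subgroup (GL (Fin 2) (ZMod q))) (F : CuspForm (R.levelOf T) 2) {g : GL (Fin 2) (ZMod q)} {γ : coverUnits X q}
    (h : (R.redHom γ)⁻¹ * g ∈ T) : (R.dockTorus T F).1 g = coverRep X q γ (R.restrictLevel T F) := by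
  have hg : g ∈ R.torusCoset T := ⟨γ, h⟩
  change (if h' : g ∈ R.torusCoset T then coverRep X q (Classical.choose h') (R.restrictLevel T F) else 0) = _
  rw [dif_pos hg]
  exact R.coverRep_restrictLevel_eq_of_witnesses T F (Classical.choose_spec hg) h

/-- The value of `dockTorus` off the double coset is `0`. -/
theorem dockTorus_apply_of_not (T : Subgroup (GL (Fin 2) (ZMod q))) (F : CuspForm (R.levelOf T) 2) {g : GL (Fin 2) (ZMod q)}
    (h : ¬ g ∈ R.torusCoset T) : (R.dockTorus T F).1 g = 0 := by
  change (if h' : g ∈ R.torusCoset T then coverRep X q (Classical.choose h') (R.restrictLevel T F) else 0) = _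
  rw [dif_neg h]

/-- `(dockTorus T F)(1) = F|_{Γ̄}`. -/
theorem dockTorus_apply_one (T : Subgroup (GL (Fin 2) (ZMod q))) (F : CuspForm (R.levelOf T) 2) : (R.dockTorus T F).1 1 = R.restrictLevel T F := by
  have h : (R.redHom 1)⁻¹ * (1 : GL (Fin 2) (ZMod q)) ∈ T := by rw [map_one, inv_one, mul_one]; exact T.one_mem
  rw [R.dockTorus_apply_of_witness T F h, map_one, Module.End.one_apply]

/-- **`dockTorus T F` is `T`-invariant** under the `GL₂(𝔽_q)`-action. -/
theorem indRep_dockTorus_of_mem (T : Subgroup (GL (Fin 2) (ZMod q))) (F : CuspForm (R.levelOf T) 2) {t : GL (Fin 2) (ZMod q)} (ht : t ∈ T) :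
    R.indRep t (R.dockTorus T F) = R.dockTorus T F := by
  apply Subtype.ext; funext g
  rw [indRep_apply]
  by_cases hg : g ∈ R.torusCoset T
  · obtain ⟨γ, hγ⟩ := hg
    have hγt : (R.redHom γ)⁻¹ * (g * t) ∈ T := by rw [← mul_assoc]; exact T.mul_mem hγ ht
    rw [R.dockTorus_apply_of_witness T F hγt, R.dockTorus_apply_of_witness T F hγ]
  · have hgt : ¬ (g * t) ∈ R.torusCoset T := by
      rintro ⟨γ, hγ⟩
      refine hg ⟨γ, ?_⟩
      have := T.mul_mem hγ (T.inv_mem ht)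
      rwa [← mul_assoc, mul_inv_cancel_right] at this
    rw [R.dockTorus_apply_of_not T F hgt, R.dockTorus_apply_of_not T F hg]

/-- Every component of `dockTorus T F` has its `Γ̄(q)`-periods in `Λ` when `F` has its `Γ_T`-periods in `Λ`. -/
theorem dockTorus_mem_componentPeriodsIn (T : Subgroup (GL (Fin 2) (ZMod q))) (F : CuspForm (R.levelOf T) 2) (Λ : Submodule ℤ ℂ)
    (hF : HasPeriodsIn (R.levelOf T) (⇑F) (Λ : Set ℂ)) : R.dockTorus T F ∈ R.componentPeriodsIn Λ := by
  intro g
  by_cases hg : g ∈ R.torusCoset T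
  · obtain ⟨γ, hγ⟩ := hg
    rw [R.dockTorus_apply_of_witness T F hγ]
    exact hasPeriodsIn_coverRep γ _ (fun δ hδ z => hF δ (R.principalLevel_le_levelOf T hδ) z)
  · rw [R.dockTorus_apply_of_not T F hg]
    exact hasPeriodsIn_zero' Λ

/-- `dockTorus T F` lies in its own period lattice `𝕃(dockTorus T F, Λ)`. -/
theorem dockTorus_mem_periodLattice (T : Subgroup (GL (Fin 2) (ZMod q))) (F : CuspForm (R.levelOf T) 2) (Λ : Submodule ℤ ℂ)
    (hF : HasPeriodsIn (R.levelOf T) (⇑F) (Λ : Set ℂ)) : R.dockTorus T F ∈ R.periodLattice Λ (R.dockTorus T F) :=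
  R.self_mem_periodLattice Λ (R.dockTorus_mem_componentPeriodsIn T F Λ hF)


/-! ## §4 Compatibility: the non-split docking of `…CartanCoverDocking` is the case `T = T_η` -/

/-- The level group over the non-split torus `T_η` IS `X.Gamma` (pinning). -/
theorem levelOf_torus_eq : R.levelOf (CartanTorusCubeCut.torusSubgroup R.η) = X.Gamma :=
  Subgroup.ext fun _ => R.mem_levelOf_torus_iff

/-- An `X.Gamma`-form regarded as a form on the level group over `T_η` (Mathlib `CuspForm.copy` along `levelOf_torus_eq`). -/
def ofGammaForm (F : CuspForm X.Gamma 2) : CuspForm (R.levelOf (CartanTorusCubeCut.torusSubgroup R.η)) 2 :=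
  F.copy (⇑F) rfl R.levelOf_torus_eq

/-- `ofGammaForm` does not change the function. -/
@[simp] theorem coe_ofGammaForm (F : CuspForm X.Gamma 2) : ⇑(R.ofGammaForm F) = ⇑F := rfl

/-- **`dockTorus T_η = dockNonsplit`**: the generic docking over the non-split torus is the docking of `…CartanCoverDocking`. -/
theorem dockTorus_torus_eq_dockNonsplit (hq : q ∈ C) (F : CuspForm X.Gamma 2) :
    R.dockTorus (CartanTorusCubeCut.torusSubgroup R.η) (R.ofGammaForm F) = R.dockNonsplit hq F := by
  apply Subtype.ext; funext g
  by_cases hg : g ∈ R.nonsplitCoset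
  · obtain ⟨γ, hγ⟩ := hg
    rw [R.dockNonsplit_apply_of_witness hq F hγ, R.dockTorus_apply_of_witness _ _ hγ]
    congr 1
  · rw [R.dockNonsplit_apply_of_not hq F hg, R.dockTorus_apply_of_not _ _ hg]

end CoverReduction

end Summit.BirchSwinnertonDyer.BirchSwinnertonDyer.Theorems.CartanCover

end
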